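import Summits.ResolutionOfSingularities.ResolutionOfSingularities.Theorems.HomologicalConductorNoZenoL1wCoreOfSandwichData
import Summits.ResolutionOfSingularities.ResolutionOfSingularities.Theorems.HomologicalConductorNoZenoSandwichData
import Literature.AlgebraicGeometry.Resolution.QuasiExcellentSchemes
import Literature.AlgebraicGeometry.Morphisms.CechH2FibreDimOne
import Literature.RingTheory.CohomologyAnnihilator.JacobianFloorKaehlerDifferent
import HarnessLib

/-!
# Crux `NoZenoR` (stmt-ResolutionOfSingularities-19943), slot 5 (B1) `stub_L1wCoreF3`: THE CLOSER (ROUTE M)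

OURS (cell res-hironaka, crux chain W4.4, lead res-L0-w44-lead-1 g9); nothing here is a statement of the manuscript under review (Hironaka
2017); AI-written, weaker than expert review.  SUPPORT-level, counted 0.  Def-free.  FACTS as explicit binders (BRICK RULE).

`l1wCore_of_facts`: the ∀-text of `Beta2Descent.Sig.L1Core HasSplitExcCurveCountLE IsSepX1Sandwiched` VERBATIM under the twelve printed
facts of `Sig.FactsW3`; `stub_L1wCoreF3_of_facts`: the same from the unfolded conjunction `Sig.FactsW3` (the registered stub's type, unfolded).
PROOF: unpack `IsSepX1Sandwiched` against the minimal resolution (`HasSplitExcCurveCountLE.finite_and_le`), take the sandwich data of ONE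
splitting polynomial (seam 0, `exists_sandwichData`, res-D-pv-039 + res-L0-w44-stub-4) and apply THE CLOSER CORE `l1wCore_of_sandwichData` (p577684).
-/

noncomputable section

-- single-problem summit: the doubled namespace component `ResolutionOfSingularities` is forced
set_option linter.dupNamespace false

open CategoryTheory CategoryTheory.Limits AlgebraicGeometry TopologicalSpace Opposite IsLocalRing Polynomial
open Literature.AlgebraicGeometry Literature.AlgebraicGeometry.Resolution Literature.AlgebraicGeometry.Motives
open Summit.ResolutionOfSingularities.ResolutionOfSingularities.Theorems.NoZeno.Birth (nrm nrm_eq_nrm)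
open Summit.ResolutionOfSingularities.ResolutionOfSingularities.Theorems.NoZeno.SandwichCluster
open Summit.ResolutionOfSingularities.ResolutionOfSingularities.Theorems.NoZeno.SandwichCluster.Parasite
  (locPrime isLocalRing_locPrime mem_locPrime_of_mem)
open Summit.ResolutionOfSingularities.ResolutionOfSingularities.Theorems.NoZeno.SandwichCluster.Thread
  (toSubring_le_locPrime isLocalization_locPrime essFiniteType_blowupChart)
open Summit.ResolutionOfSingularities.ResolutionOfSingularities.Theorems.NoZeno.SplittingBase
open Summit.ResolutionOfSingularities.ResolutionOfSingularities.Theorems.SyzygyFlattening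
  (self_le_nrm isIntegrallyClosed_nrm stub_essFiniteType_nrm)

namespace Summit.ResolutionOfSingularities.ResolutionOfSingularities.Theorems.NoZeno.ExcCount

/-- **`Sig.L1Core HasSplitExcCurveCountLE IsSepX1Sandwiched` (text verbatim) under the printed facts of `Sig.FactsW3`.**
[cite: Lipman1969, Theorem (4.1) (p. 204), Proposition (16.1)(ii), Corollary (27.3) (p. 277)] -/
theorem l1wCore_of_facts
    (h131b : Lipman1969_13_1_b_rat.{0}) (h131d : Lipman1969_13_1_d_rat.{0})
    (h15a : Lipman1969_15_a.{0}) (_h15b : Lipman1969_15_b.{0})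
    (h12 : Lipman1969_1_2.{0}) (h41 : Lipman1969_4_1.{0}) (h121i : Lipman1969_12_1_i.{0})
    (_h121ii : Lipman1969_12_1_ii.{0}) (h161 : Lipman1969_16_1_ii.{0}) (h165 : Lipman1969_16_5.{0})
    (_h271 : Lipman1969_27_1_reg_rat.{0}) (h273 : Lipman1969_27_3_rat.{0}) :
    ∀ (k K : Type) [Field k] [Field K] [Algebra k K] (T : Subalgebra k K) (P : Ideal ↥T) (hP : P.IsPrime),
    Algebra.EssFiniteType k ↥T → IsIntegrallyClosed ↥T → IsFractionRing ↥T K →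
    ringKrullDim ↥(locPrime T P hP) = 2 →
    HasRationalSingularity ↥(locPrime T P hP) →
    ∀ (N : ℕ), @HasSplitExcCurveCountLE ↥(locPrime T P hP) _ (isLocalRing_locPrime T P hP) N →
    ∀ (C : Set K), C ⊆ (T : Set K) →
      (Ideal.span {d : ↥(locPrime T P hP) | (d : K) ∈ C}).radical =
        @maximalIdeal ↥(locPrime T P hP) _ (isLocalRing_locPrime T P hP) →
      @IsSepX1Sandwiched ↥(locPrime T P hP) _ (isLocalRing_locPrime T P hP)
        (Ideal.span {d : ↥(locPrime T P hP) | (d : K) ∈ C}) →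
    ∀ (x : K), x ∈ C → x ≠ 0 →
    ∀ (B : Subalgebra k K),
      B = Algebra.adjoin k ((locPrime T P hP : Set K) ∪ {y : K | ∃ c ∈ C, y = c * x⁻¹}) →
    ∀ (𝔮 : Ideal ↥(nrm B)) (h𝔮 : 𝔮.IsPrime) (D' : Subring K) (hD' : IsLocalRing ↥D'),
      locPrime (nrm B) 𝔮 h𝔮 = D' → (locPrime T P hP : Set K) ⊆ D' →
      ringKrullDim ↥D' = 2 → IsIntegrallyClosed ↥D' →
      IsRegularLocalRing ↥D' ∨ (HasRationalSingularity ↥D' ∧ @HasSplitExcCurveCountLE ↥D' _ hD' (N - 1)) := by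
  intro k K _ _ _ T P hP hET hnT hfr hdim hrat N hN C hCT hrad hS x hxC hx0 B hB 𝔮 h𝔮 D' hD' hEq hDD' hdim' hnorm'
  haveI := isLocalRing_locPrime T P hP
  haveI := hP
  haveI := hET
  haveI := hnT
  haveI := hfr
  -- (1) unpack `IsSepX1Sandwiched` against the minimal resolution
  obtain ⟨X, π, hπmin, X1, ρ, hρ, hprin⟩ := hS
  obtain ⟨hfin, hle⟩ := HasSplitExcCurveCountLE.finite_and_le hN hπmin
  -- (2) seam 0: the sandwich data of ONE splitting polynomial (res-D-pv-039 `exists_sandwichData`, with res-L0-w44-stub-4 / pv-045 / o5 / stub-3 bricks)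
  obtain ⟨f, hf, hirr, hsep, hFact, hPf, hπf, hNf, hw1f, hNcfin, hNccl, hρf, hsplitf, hprinf⟩ :=
    exists_sandwichData h131d h161 h165 T P hP hdim hrat N C hCT π hπmin.1 hfin hle ρ hρ hprin
  -- (3) THE CLOSER CORE (Route M)
  haveI := hFact
  exact l1wCore_of_sandwichData h131b h131d h15a h12 h41 h121i h161 h165 h273 T P hP hdim hrat N C hCT hrad x hxC hx0 B hB 𝔮 h𝔮
    D' hD' hEq hDD' hdim' hnorm' π ρ f hf hirr hsep hPf hπf hNf hw1f hNcfin hNccl hρf hsplitf hprinf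

/-- **The registered stub `stub_L1wCoreF3` with `Sig.FactsW3` UNFOLDED**: the printed-fact conjunction implies the `Sig.L1Core` text.
[cite: Lipman1969, Theorem (4.1) (p. 204), Proposition (16.1)(ii), Corollary (27.3) (p. 277)] -/
theorem stub_L1wCoreF3_of_facts
    (hF3 : (((CossartJannsenSaito2020General.{0} ∧ Lipman1969_1_2.{0} ∧ Lipman1969_4_1.{0} ∧ Lipman1969_12_1_i.{0} ∧
        Lipman1969_12_1_ii.{0} ∧ Literature.AlgebraicGeometry.Morphisms.GortzWedhorn2023_24_44_H2.{0}) ∧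
      (Lipman1969_16_1_ii.{0} ∧ Lipman1969_16_5.{0} ∧ Lipman1969_27_1_reg_rat.{0} ∧ Lipman1969_27_3_rat.{0})) ∧
      Literature.RingTheory.CohomologyAnnihilator.jacobianFloorNN_normal_dim3.{0}) ∧
      (Lipman1969_13_1_b_rat.{0} ∧ Lipman1969_13_1_d_rat.{0}) ∧ (Lipman1969_15_a.{0} ∧ Lipman1969_15_b.{0})) :
    ∀ (k K : Type) [Field k] [Field K] [Algebra k K] (T : Subalgebra k K) (P : Ideal ↥T) (hP : P.IsPrime),
    Algebra.EssFiniteType k ↥T → IsIntegrallyClosed ↥T → IsFractionRing ↥T K →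
    ringKrullDim ↥(locPrime T P hP) = 2 →
    HasRationalSingularity ↥(locPrime T P hP) →
    ∀ (N : ℕ), @HasSplitExcCurveCountLE ↥(locPrime T P hP) _ (isLocalRing_locPrime T P hP) N →
    ∀ (C : Set K), C ⊆ (T : Set K) →
      (Ideal.span {d : ↥(locPrime T P hP) | (d : K) ∈ C}).radical =
        @maximalIdeal ↥(locPrime T P hP) _ (isLocalRing_locPrime T P hP) →
      @IsSepX1Sandwiched ↥(locPrime T P hP) _ (isLocalRing_locPrime T P hP)
        (Ideal.span {d : ↥(locPrime T P hP) | (d : K) ∈ C}) →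
    ∀ (x : K), x ∈ C → x ≠ 0 →
    ∀ (B : Subalgebra k K),
      B = Algebra.adjoin k ((locPrime T P hP : Set K) ∪ {y : K | ∃ c ∈ C, y = c * x⁻¹}) →
    ∀ (𝔮 : Ideal ↥(nrm B)) (h𝔮 : 𝔮.IsPrime) (D' : Subring K) (hD' : IsLocalRing ↥D'),
      locPrime (nrm B) 𝔮 h𝔮 = D' → (locPrime T P hP : Set K) ⊆ D' →
      ringKrullDim ↥D' = 2 → IsIntegrallyClosed ↥D' →
      IsRegularLocalRing ↥D' ∨ (HasRationalSingularity ↥D' ∧ @HasSplitExcCurveCountLE ↥D' _ hD' (N - 1)) :=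
  l1wCore_of_facts hF3.2.1.1 hF3.2.1.2 hF3.2.2.1 hF3.2.2.2 hF3.1.1.1.2.1 hF3.1.1.1.2.2.1 hF3.1.1.1.2.2.2.1 hF3.1.1.1.2.2.2.2.1
    hF3.1.1.2.1 hF3.1.1.2.2.1 hF3.1.1.2.2.2.1 hF3.1.1.2.2.2.2

end Summit.ResolutionOfSingularities.ResolutionOfSingularities.Theorems.NoZeno.ExcCount

end
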